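import Summits.QuantumFields.YangMills.Theorems.LuscherReductionTwistedTraceScalingBOStiffFibreGapDoor
import Summits.QuantumFields.YangMills.Theorems.LuscherReductionTwistedTraceScalingBOStiffCentralFloor
import HarnessLib

/-!
# R66 — The flat-Poincaré door imposes a CONDUCTANCE FLOOR: `J₀` must reach every gauge offset of `cS` (else `hflat` fails for every `δ < 1`)
# (crux `LuscherReduction.TwistedTraceScaling`, stmt-QuantumFields-20203; bears on lane A's (B-ST) specs `spec_gap_inputs`/`spec_S3` (g21-FibreBlock-spec), the
# `hflat`/`hJ` inputs of ✓`StiffDoor.hgap_of_door`, and the planned (B4) `…BOStiffCentralLower`)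

Standing-disprover cycle 54.  The door ✓`hgap_of_door` couples its flat reference `(D, J₀, P₀, δ)` to the fibre data only through `hν, hν'` (`Θ²w ≍ D` on `S`) and the
jump floor `hJ : c_J·Λ·J₀ ≤ Θ·M·Θ`, and asks the FLAT POINCARÉ INEQUALITY `hflat` for EVERY bounded measurable `g` vanishing off `S`.  Tested at indicators `g = 𝟙_A`:
* §1 (abstract, the door's vocabulary) ★★ `flat_indicator` — `D(A) − D(A)²/D(S) ≤ P₀·½∫∫(𝟙_A x − 𝟙_A y)² J₀ + δ·D(A)` for measurable `A ⊆ S`;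
  ★★ `door_false_of_isolated` — `J₀ ≤ 0` across the cut `(A, Aᶜ)` (e.g. `J₀` VANISHES there) with `0 < D(A) < (1 − δ)D(S)` makes the door hypotheses contradictory:
  `hflat` with `δ < 1` forces `J₀` to connect every `D`-non-null piece of `S` to the rest; ★★★ `conductance_floor` — with `hJ` the cost is paid in the FIBRE kernel,
  `(c_JΛ/P₀)·(D(A)(1 − δ) − D(A)²/D(S)) ≤ ½∫∫(𝟙_A x − 𝟙_A y)²·ΘMΘ`, and ★ `half_jump_indicator_eq` — for symmetric `K` the right side is the cut flow `∫_A∫_{Aᶜ} K`: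
  the door's `P₀` is at least `c_JΛ` times the inverse CONDUCTANCE of the weighted graph `(S, ΘMΘ, D)`.
* §2 (literal objects of ✓`…BOStiffDefs`) ★★ `exists_mem_cS_pureGauge` — for `L ≥ 2` and every `0 ≤ R ≤ r(β) = min(1/40, β^{-1/2}btLog β)` the support `cS L β` contains a
  PURE-GAUGE point (`P_Γ y = y`, `‖y‖ = R`, `y = linkEmbed x`) with `cΘ L β x = exp(−R²/(powScale 1 β)²)`: the support is GAUGE-WIDE (gauge radius `β^{-1/2}btLog β`)
  although the profile's gauge Gaussian has width `powScale 1 β = β^{-1}`; ★ `cΘ_gauge_floor_attained`, ★ `floor_le_gauge_value` (any floor `θ₀ ≤ exp(−r(β)²β²)`-type).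
* §3 ★★ `central_conductance_floor` — §1 for `S = cS L β`, `Θ = cΘ L β`, `M = cM L β` (symmetric), `Λ = cΛ L s M β`: for ANY admissible `(D, J₀, P₀, δ, c_J)` of the
  inner block of `spec_gap_inputs` and any measurable `A ⊆ cS L β`, `(c_J·cΛ/P₀)·(D(A)(1 − δ) − D(A)²/D(cS)) ≤ ∫_A∫_{Aᶜ} cΘ·cM·cΘ dπ dπ`.

READING FOR LANE A (a requirement, not a kill).  `cM` is the FULL based-Haar average of the heat kernel, gauge-flat on `cS × cS` (it reaches gauge offsets `2r(β)`), so the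
natural instance `J₀ := cΘcMcΘ/(c_JcΛ)·𝟙_{cS×cS}`, `D := cΘ²cW` is consistent and §3 is harmless for it.  But a minorant `J₀` built from the lower half of
✓`transferKernel_chart_sandwich` on a based ball of radius `β^{-1/2}btLog^{1/3}β` CENTRED AT `h = 1` ((B4) as planned, HANDOFF-g21 START HERE) vanishes at gauge offsets
`≳ β^{-1/2}btLog^{1/3}β`, i.e. on most of `cS × cS` (§2); for such a gauge-LOCAL `J₀`, §1/§3 with `A` a far gauge shell `cS ∩ {‖P_Γ y‖ > R₁}` force
`P₀ ≳ c_J(1 − δ − D(A)/D(S))·D(A)/flow(A)`, Gaussian-large in `β(R₁ − ϱ)`, and an exactly isolated shell makes `hflat` FALSE for every `δ < 1` (`door_false_of_isolated`).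
Repairs (cheap, theirs): centre the based ball at the gauge peak `h*(y, y')` (`|h*| ≲ C_L r(β)`, chart slack `e^{±O(ρ³β)} → 1`), or take its radius `≥ C_L·2r(β)` as the (OD) pen
did (`central_gaussian_tube_lower`, `ρ = 128Lβ^{-1/2}btLog²β`), or re-spec the fibre block on `cS ∩ {‖P_Γ y‖ ≤ β^{-1}ℓ'}`.
HONEST FRAMING: sorry-free measure-theoretic bookkeeping for a stub ((B-ST) Poincaré pen of S-BASE) of a child of the CONDITIONAL reduction route R2b1; no kernel estimate is
refuted or proved; `spec_gap_inputs`/`spec_S3` are NOT refuted (their natural instance survives); (B-ST) OPEN; C4-CORE OPEN; not infinite volume, not a gap, not Clay.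

## References
* G. F. Lawler, A. D. Sokal, *Bounds on the L² spectrum for Markov chains and Markov processes*, Trans. AMS 309 (1988) 557–580, Thm 2.1 (Poincaré constant vs conductance,
  indicator test functions). [folklore use]
* M. Fukushima, Y. Oshima, M. Takeda, *Dirichlet Forms and Symmetric Markov Processes*, de Gruyter 2011, §1.1, §4.4 (jump/killing forms). [FukushimaOshimaTakeda2011]
* M. Lüscher, *Some analytic results concerning the mass spectrum of Yang–Mills gauge theories on a torus*, Nucl. Phys. B219 (1983) 233–261, §3. [Luscher1983]
-/

set_option autoImplicit false

noncomputable section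

open Real MeasureTheory Filter Topology Set
open scoped BigOperators RealInnerProductSpace
open Literature.MathematicalPhysics.QuantumFieldTheory hiding SU2
open Literature.MathematicalPhysics.QuantumLattice

namespace Summit.QuantumFields.YangMills.Theorems.TwistedTraceScaling.Negative.R66

open Summit.QuantumFields.YangMills.Theorems.FemtoTransferGap
open Summit.QuantumFields.YangMills.Theorems.FemtoTransferGap.StiffDoor
open Summit.QuantumFields.YangMills.Theorems.FemtoTransferGap.TwoLattice
open Summit.QuantumFields.YangMills.Theorems.FemtoTransferGap.TwoLattice.Avg
open Summit.QuantumFields.YangMills.Theorems.FemtoTransferGap.TwoLattice.ConstTube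
open Summit.QuantumFields.YangMills.Theorems.FemtoTransferGap.TwoLattice.Stiff
open Summit.QuantumFields.YangMills.Theorems.FemtoTransferGap.TwoLattice.GnChart
open Summit.QuantumFields.YangMills.Theorems.FemtoTransferGap.TwoLattice.Cov

/-! ## §1 The flat Poincaré inequality at indicators: isolation is forbidden, conductance is floored -/

section Abstract

variable {X : Type*}

/-- `(𝟙_A x − 𝟙_A y)² ≤ 1`. [folklore] -/
theorem indicator_sub_sq_le_one (A : Set X) (x y : X) : (A.indicator (fun _ => (1 : ℝ)) x - A.indicator (fun _ => (1 : ℝ)) y) ^ 2 ≤ 1 := by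
  by_cases hx : x ∈ A <;> by_cases hy : y ∈ A <;> simp [indicator_of_mem, indicator_of_notMem, hx, hy]

/-- Across a cut where the kernel is `≤ 0` the indicator jump integrand is `≤ 0` (it vanishes when `x, y` lie on the same side). [folklore] -/
theorem indicator_sub_sq_mul_nonpos_of_cut {A : Set X} {J : X → X → ℝ} (hcut : ∀ x ∈ A, ∀ y ∉ A, J x y ≤ 0 ∧ J y x ≤ 0) (x y : X) :
    (A.indicator (fun _ => (1 : ℝ)) x - A.indicator (fun _ => (1 : ℝ)) y) ^ 2 * J x y ≤ 0 := by
  by_cases hx : x ∈ A <;> by_cases hy : y ∈ A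
  · simp [indicator_of_mem hx, indicator_of_mem hy]
  · rw [indicator_of_mem hx, indicator_of_notMem hy]; have := (hcut x hx y hy).1; nlinarith
  · rw [indicator_of_notMem hx, indicator_of_mem hy]; have := (hcut y hy x hx).2; nlinarith
  · simp [indicator_of_notMem hx, indicator_of_notMem hy]

variable [MeasurableSpace X] {μ : Measure X}

/-- ★★ **`hflat` at an indicator.**  The door's flat Poincaré inequality (verbatim the `hflat` hypothesis of ✓`StiffDoor.hgap_of_door`), tested at `g = 𝟙_A` for a measurable
`A ⊆ S`, reads `D(A) − D(A)²/D(S) ≤ P₀·½∫∫(𝟙_A x − 𝟙_A y)² J₀ + δ·D(A)`. [folklore] -/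
theorem flat_indicator {S A : Set X} (hA : MeasurableSet A) (hAS : A ⊆ S) {D : X → ℝ} {J₀ : X → X → ℝ} {P₀ δ : ℝ}
    (hflat : ∀ g : X → ℝ, Measurable g → (∃ C : ℝ, ∀ x, |g x| ≤ C) → (∀ x, x ∉ S → g x = 0) →
      (∫ x in S, g x ^ 2 * D x ∂μ) - (∫ x in S, g x * D x ∂μ) ^ 2 / (∫ x in S, D x ∂μ) ≤
        P₀ * ((1 / 2) * ∫ x, ∫ y, (g x - g y) ^ 2 * J₀ x y ∂μ ∂μ) + δ * ∫ x in S, g x ^ 2 * D x ∂μ) :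
    (∫ x in A, D x ∂μ) - (∫ x in A, D x ∂μ) ^ 2 / (∫ x in S, D x ∂μ) ≤
      P₀ * ((1 / 2) * ∫ x, ∫ y, (A.indicator (fun _ => (1 : ℝ)) x - A.indicator (fun _ => (1 : ℝ)) y) ^ 2 * J₀ x y ∂μ ∂μ) + δ * ∫ x in A, D x ∂μ := by
  set g : X → ℝ := A.indicator (fun _ => (1 : ℝ)) with hg
  have hgm : Measurable g := measurable_const.indicator hA
  have hcase : ∀ x, g x ^ 2 * D x = A.indicator D x ∧ g x * D x = A.indicator D x ∧ |g x| ≤ 1 := fun x => by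
    by_cases hx : x ∈ A <;> simp [hg, indicator_of_mem, indicator_of_notMem, hx]
  have hgb : ∃ C : ℝ, ∀ x, |g x| ≤ C := ⟨1, fun x => (hcase x).2.2⟩
  have hgS : ∀ x, x ∉ S → g x = 0 := fun x hx => indicator_of_notMem (fun h => hx (hAS h)) _
  have h1 : (fun x => g x ^ 2 * D x) = A.indicator D := funext fun x => (hcase x).1
  have h2 : (fun x => g x * D x) = A.indicator D := funext fun x => (hcase x).2.1
  have hI : ∫ x in S, A.indicator D x ∂μ = ∫ x in A, D x ∂μ := by
    rw [setIntegral_indicator hA, inter_eq_right.mpr hAS]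
  have h := hflat g hgm hgb hgS
  rw [h1, h2, hI] at h
  exact h

/-- ★★ **Isolation is forbidden.**  If the jump kernel is `≤ 0` across the cut `(A, Aᶜ)` — in particular if it VANISHES there — while `A ⊆ S` carries `D`-mass
`0 < D(A) < (1 − δ)·D(S)`, then the flat Poincaré hypothesis `hflat` (any `P₀ ≥ 0`) is contradictory: `hflat` with killing slack `δ < 1` forces `J₀` to CONNECT every
`D`-non-null measurable piece of `S` to the rest of `S`. [folklore] -/
theorem door_false_of_isolated {S A : Set X} (hA : MeasurableSet A) (hAS : A ⊆ S) {D : X → ℝ} {J₀ : X → X → ℝ} {P₀ δ : ℝ} (hP₀ : 0 ≤ P₀)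
    (hflat : ∀ g : X → ℝ, Measurable g → (∃ C : ℝ, ∀ x, |g x| ≤ C) → (∀ x, x ∉ S → g x = 0) →
      (∫ x in S, g x ^ 2 * D x ∂μ) - (∫ x in S, g x * D x ∂μ) ^ 2 / (∫ x in S, D x ∂μ) ≤
        P₀ * ((1 / 2) * ∫ x, ∫ y, (g x - g y) ^ 2 * J₀ x y ∂μ ∂μ) + δ * ∫ x in S, g x ^ 2 * D x ∂μ)
    (hcut : ∀ x ∈ A, ∀ y ∉ A, J₀ x y ≤ 0 ∧ J₀ y x ≤ 0)
    (hDS : 0 < ∫ x in S, D x ∂μ) (hApos : 0 < ∫ x in A, D x ∂μ) (hAlt : ∫ x in A, D x ∂μ < (1 - δ) * ∫ x in S, D x ∂μ) : False := by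
  have h := flat_indicator (μ := μ) hA hAS hflat
  have hflow : ∫ x, ∫ y, (A.indicator (fun _ => (1 : ℝ)) x - A.indicator (fun _ => (1 : ℝ)) y) ^ 2 * J₀ x y ∂μ ∂μ ≤ 0 :=
    integral_nonpos fun x => integral_nonpos fun y => indicator_sub_sq_mul_nonpos_of_cut hcut x y
  set a := ∫ x in A, D x ∂μ
  set s := ∫ x in S, D x ∂μ
  have h4 : P₀ * ((1 / 2) * ∫ x, ∫ y, (A.indicator (fun _ => (1 : ℝ)) x - A.indicator (fun _ => (1 : ℝ)) y) ^ 2 * J₀ x y ∂μ ∂μ) ≤ 0 :=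
    mul_nonpos_iff.mpr (Or.inl ⟨hP₀, by linarith⟩)
  have h3 : a * (1 - δ) ≤ a ^ 2 / s := by linarith
  have h5 : a * (1 - δ) * s ≤ a ^ 2 := by
    have := mul_le_mul_of_nonneg_right h3 hDS.le
    rwa [div_mul_cancel₀ _ hDS.ne'] at this
  have h6 : a * a < a * ((1 - δ) * s) := mul_lt_mul_of_pos_left hAlt hApos
  nlinarith

variable [IsFiniteMeasure μ]

/-- The indicator jump integrands against a bounded measurable kernel are bounded and measurable, hence their iterated integral is the product integral. [folklore] -/
theorem indicator_jump_data {A : Set X} (hA : MeasurableSet A) {K : X → X → ℝ} (hK : Measurable (Function.uncurry K)) {C : ℝ} (hKb : ∀ x y, |K x y| ≤ C) :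
    Measurable (Function.uncurry fun x y => (A.indicator (fun _ => (1 : ℝ)) x - A.indicator (fun _ => (1 : ℝ)) y) ^ 2 * K x y) ∧
      (∀ x y, |(A.indicator (fun _ => (1 : ℝ)) x - A.indicator (fun _ => (1 : ℝ)) y) ^ 2 * K x y| ≤ C) ∧
      Integrable (Function.uncurry fun x y => (A.indicator (fun _ => (1 : ℝ)) x - A.indicator (fun _ => (1 : ℝ)) y) ^ 2 * K x y) (μ.prod μ) ∧
      ∫ x, ∫ y, (A.indicator (fun _ => (1 : ℝ)) x - A.indicator (fun _ => (1 : ℝ)) y) ^ 2 * K x y ∂μ ∂μ =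
        ∫ p, (A.indicator (fun _ => (1 : ℝ)) p.1 - A.indicator (fun _ => (1 : ℝ)) p.2) ^ 2 * K p.1 p.2 ∂(μ.prod μ) := by
  have hg : Measurable (A.indicator (fun _ => (1 : ℝ))) := measurable_const.indicator hA
  have hm : Measurable (Function.uncurry fun x y => (A.indicator (fun _ => (1 : ℝ)) x - A.indicator (fun _ => (1 : ℝ)) y) ^ 2 * K x y) :=
    (((hg.comp measurable_fst).sub (hg.comp measurable_snd)).pow_const 2).mul hK
  have hb : ∀ x y, |(A.indicator (fun _ => (1 : ℝ)) x - A.indicator (fun _ => (1 : ℝ)) y) ^ 2 * K x y| ≤ C := fun x y => by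
    rw [abs_mul, abs_of_nonneg (sq_nonneg _)]
    have hC : 0 ≤ C := (abs_nonneg _).trans (hKb x y)
    calc _ ≤ 1 * |K x y| := mul_le_mul_of_nonneg_right (indicator_sub_sq_le_one A x y) (abs_nonneg _)
      _ ≤ C := by rw [one_mul]; exact hKb x y
  exact ⟨hm, hb, integrable_prod_of_bdd (μ := μ) hm hb, integral_integral_eq_prod (μ := μ) hm hb⟩

/-- ★★★ **The conductance floor.**  Under the door's flat Poincaré hypothesis `hflat` and its jump floor `hJ : c_J·Λ·J₀ ≤ Θ·M·Θ` (both verbatim from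
✓`StiffDoor.hgap_of_door`; `Θ, M, J₀` bounded measurable, `μ` finite), every measurable `A ⊆ S` satisfies
`(c_J Λ / P₀)·(D(A)(1 − δ) − D(A)²/D(S)) ≤ ½∫∫(𝟙_A x − 𝟙_A y)²·Θ(x)M(x,y)Θ(y)`: the Poincaré constant the door can be fed is at least `c_JΛ` times the inverse
conductance of the weighted graph `(S, ΘMΘ, D)`. [folklore] -/
theorem conductance_floor {S A : Set X} (hA : MeasurableSet A) (hAS : A ⊆ S) {D Θ : X → ℝ} {M J₀ : X → X → ℝ} {P₀ δ cJ Λ CM CΘ CJ : ℝ}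
    (hP₀ : 0 < P₀) (hcJ : 0 < cJ) (hΛ : 0 < Λ)
    (hM : Measurable (Function.uncurry M)) (hMb : ∀ x y, |M x y| ≤ CM) (hΘ : Measurable Θ) (hΘb : ∀ x, |Θ x| ≤ CΘ)
    (hJ₀ : Measurable (Function.uncurry J₀)) (hJ₀b : ∀ x y, |J₀ x y| ≤ CJ)
    (hJ : ∀ x y, cJ * (Λ * J₀ x y) ≤ Θ x * M x y * Θ y)
    (hflat : ∀ g : X → ℝ, Measurable g → (∃ C : ℝ, ∀ x, |g x| ≤ C) → (∀ x, x ∉ S → g x = 0) →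
      (∫ x in S, g x ^ 2 * D x ∂μ) - (∫ x in S, g x * D x ∂μ) ^ 2 / (∫ x in S, D x ∂μ) ≤
        P₀ * ((1 / 2) * ∫ x, ∫ y, (g x - g y) ^ 2 * J₀ x y ∂μ ∂μ) + δ * ∫ x in S, g x ^ 2 * D x ∂μ) :
    (cJ * Λ / P₀) * ((∫ x in A, D x ∂μ) * (1 - δ) - (∫ x in A, D x ∂μ) ^ 2 / (∫ x in S, D x ∂μ)) ≤
      (1 / 2) * ∫ x, ∫ y, (A.indicator (fun _ => (1 : ℝ)) x - A.indicator (fun _ => (1 : ℝ)) y) ^ 2 * (Θ x * M x y * Θ y) ∂μ ∂μ := by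
  have h := flat_indicator (μ := μ) hA hAS hflat
  -- the kernel `ΘMΘ` is bounded measurable
  have hKm : Measurable (Function.uncurry fun x y => Θ x * M x y * Θ y) :=
    ((hΘ.comp measurable_fst).mul hM).mul (hΘ.comp measurable_snd)
  have hKb : ∀ x y, |Θ x * M x y * Θ y| ≤ CΘ * CM * CΘ := fun x y => by
    have hCΘ : 0 ≤ CΘ := (abs_nonneg _).trans (hΘb x)
    have hCM : 0 ≤ CM := (abs_nonneg _).trans (hMb x y)
    rw [abs_mul, abs_mul]
    exact mul_le_mul (mul_le_mul (hΘb x) (hMb x y) (abs_nonneg _) hCΘ) (hΘb y) (abs_nonneg _) (mul_nonneg hCΘ hCM)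
  obtain ⟨-, -, i1, e1⟩ := indicator_jump_data (μ := μ) hA hJ₀ hJ₀b
  obtain ⟨-, -, i2, e2⟩ := indicator_jump_data (μ := μ) hA hKm hKb
  -- pointwise comparison `c_JΛ·(𝟙x − 𝟙y)²J₀ ≤ (𝟙x − 𝟙y)²ΘMΘ`, integrated on the product
  have hle : (∫ p, (A.indicator (fun _ => (1 : ℝ)) p.1 - A.indicator (fun _ => (1 : ℝ)) p.2) ^ 2 * J₀ p.1 p.2 ∂(μ.prod μ)) * (cJ * Λ) ≤
      ∫ p, (A.indicator (fun _ => (1 : ℝ)) p.1 - A.indicator (fun _ => (1 : ℝ)) p.2) ^ 2 * (Θ p.1 * M p.1 p.2 * Θ p.2) ∂(μ.prod μ) := by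
    rw [← integral_mul_const]
    refine integral_mono (i1.mul_const _) i2 fun p => ?_
    have h0 := sq_nonneg (A.indicator (fun _ => (1 : ℝ)) p.1 - A.indicator (fun _ => (1 : ℝ)) p.2)
    have h1 := hJ p.1 p.2
    show (A.indicator (fun _ => (1 : ℝ)) p.1 - A.indicator (fun _ => (1 : ℝ)) p.2) ^ 2 * J₀ p.1 p.2 * (cJ * Λ) ≤
      (A.indicator (fun _ => (1 : ℝ)) p.1 - A.indicator (fun _ => (1 : ℝ)) p.2) ^ 2 * (Θ p.1 * M p.1 p.2 * Θ p.2)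
    nlinarith [mul_le_mul_of_nonneg_left h1 h0]
  rw [e1] at h
  rw [e2]
  set IJ := ∫ p, (A.indicator (fun _ => (1 : ℝ)) p.1 - A.indicator (fun _ => (1 : ℝ)) p.2) ^ 2 * J₀ p.1 p.2 ∂(μ.prod μ)
  set IK := ∫ p, (A.indicator (fun _ => (1 : ℝ)) p.1 - A.indicator (fun _ => (1 : ℝ)) p.2) ^ 2 * (Θ p.1 * M p.1 p.2 * Θ p.2) ∂(μ.prod μ)
  set a := ∫ x in A, D x ∂μ
  set s := ∫ x in S, D x ∂μ
  have hcΛ : 0 < cJ * Λ := mul_pos hcJ hΛ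
  have h8 : a * (1 - δ) - a ^ 2 / s ≤ (P₀ / 2) * IJ := by linarith
  have h7 : cJ * Λ * (a * (1 - δ) - a ^ 2 / s) ≤ (P₀ / 2) * IK := by
    have := mul_le_mul_of_nonneg_left h8 hcΛ.le
    nlinarith [mul_le_mul_of_nonneg_left hle (by positivity : (0 : ℝ) ≤ P₀ / 2)]
  calc (cJ * Λ / P₀) * (a * (1 - δ) - a ^ 2 / s) = (1 / P₀) * (cJ * Λ * (a * (1 - δ) - a ^ 2 / s)) := by ring
    _ ≤ (1 / P₀) * ((P₀ / 2) * IK) := mul_le_mul_of_nonneg_left h7 (by positivity)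
    _ = (1 / 2) * IK := by field_simp

/-- ★ **The cut form of the indicator jump form** (symmetric kernel): `½∫∫(𝟙_A x − 𝟙_A y)² K = ∫_A ∫_{Aᶜ} K` — the `K`-flow out of `A`. [folklore] -/
theorem half_jump_indicator_eq {A : Set X} (hA : MeasurableSet A) {K : X → X → ℝ} (hK : Measurable (Function.uncurry K)) {C : ℝ} (hKb : ∀ x y, |K x y| ≤ C)
    (hsymm : ∀ x y, K x y = K y x) :
    (1 / 2) * ∫ x, ∫ y, (A.indicator (fun _ => (1 : ℝ)) x - A.indicator (fun _ => (1 : ℝ)) y) ^ 2 * K x y ∂μ ∂μ = ∫ x in A, ∫ y in Aᶜ, K x y ∂μ ∂μ := by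
  -- the two one-sided pieces
  set F₁ : X → X → ℝ := fun x y => A.indicator (fun _ => (1 : ℝ)) x * (Aᶜ.indicator (fun _ => (1 : ℝ)) y * K x y) with hF₁
  set F₂ : X → X → ℝ := fun x y => Aᶜ.indicator (fun _ => (1 : ℝ)) x * (A.indicator (fun _ => (1 : ℝ)) y * K x y) with hF₂
  have hsplit : ∀ x y, (A.indicator (fun _ => (1 : ℝ)) x - A.indicator (fun _ => (1 : ℝ)) y) ^ 2 * K x y = F₁ x y + F₂ x y := fun x y => by
    by_cases hx : x ∈ A <;> by_cases hy : y ∈ A <;> simp [hF₁, hF₂, indicator, hx, hy]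
  have hgA : Measurable (A.indicator (fun _ => (1 : ℝ))) := measurable_const.indicator hA
  have hgAc : Measurable (Aᶜ.indicator (fun _ => (1 : ℝ))) := measurable_const.indicator hA.compl
  have hind : ∀ (B : Set X) (z : X), |B.indicator (fun _ => (1 : ℝ)) z| ≤ 1 := fun B z => by
    by_cases hz : z ∈ B <;> simp [indicator_of_mem, indicator_of_notMem, hz]
  have hC0 : ∀ x y, 0 ≤ C := fun x y => (abs_nonneg _).trans (hKb x y)
  have m1 : Measurable (Function.uncurry F₁) := (hgA.comp measurable_fst).mul ((hgAc.comp measurable_snd).mul hK)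
  have m2 : Measurable (Function.uncurry F₂) := (hgAc.comp measurable_fst).mul ((hgA.comp measurable_snd).mul hK)
  have b1 : ∀ x y, |F₁ x y| ≤ C := fun x y => by
    simp only [hF₁]; rw [abs_mul, abs_mul]
    calc _ ≤ 1 * (1 * C) := mul_le_mul (hind A x) (mul_le_mul (hind Aᶜ y) (hKb x y) (abs_nonneg _) zero_le_one) (by positivity) zero_le_one
      _ = C := by ring
  have b2 : ∀ x y, |F₂ x y| ≤ C := fun x y => by
    simp only [hF₂]; rw [abs_mul, abs_mul]
    calc _ ≤ 1 * (1 * C) := mul_le_mul (hind Aᶜ x) (mul_le_mul (hind A y) (hKb x y) (abs_nonneg _) zero_le_one) (by positivity) zero_le_one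
      _ = C := by ring
  -- `∫∫ F₁ = ∫_A ∫_{Aᶜ} K`
  have e1 : ∫ x, ∫ y, F₁ x y ∂μ ∂μ = ∫ x in A, ∫ y in Aᶜ, K x y ∂μ ∂μ := by
    have hin : ∀ x, ∫ y, F₁ x y ∂μ = A.indicator (fun x => ∫ y in Aᶜ, K x y ∂μ) x := fun x => by
      simp only [hF₁]
      rw [integral_const_mul]
      have : (fun y => Aᶜ.indicator (fun _ => (1 : ℝ)) y * K x y) = Aᶜ.indicator (K x) := funext fun y => by
        by_cases hy : y ∈ Aᶜ <;> simp [indicator_of_mem, indicator_of_notMem, hy]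
      rw [this, integral_indicator hA.compl]
      by_cases hx : x ∈ A <;> simp [indicator_of_mem, indicator_of_notMem, hx]
    simp_rw [hin]
    exact integral_indicator hA
  -- `∫∫ F₂ = ∫∫ F₁` by swapping the variables and the symmetry of `K`
  have e2 : ∫ x, ∫ y, F₂ x y ∂μ ∂μ = ∫ x, ∫ y, F₁ x y ∂μ ∂μ := by
    rw [integral_integral_eq_prod (μ := μ) m2 b2, integral_integral_eq_prod (μ := μ) m1 b1,
      ← integral_prod_swap (μ := μ) (ν := μ) (fun p : X × X => F₁ p.1 p.2)]
    refine integral_congr_ae (ae_of_all _ fun p => ?_)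
    simp only [hF₁, hF₂, Prod.swap]
    rw [hsymm p.2 p.1]; ring
  -- assemble
  have i1 : Integrable (fun x => ∫ y, F₁ x y ∂μ) μ := by
    obtain ⟨hm, hb⟩ := measurable_integral_right_of_bdd (μ := μ) m1 b1
    exact integrable_of_measurable_abs_le μ hm hb
  have i2 : Integrable (fun x => ∫ y, F₂ x y ∂μ) μ := by
    obtain ⟨hm, hb⟩ := measurable_integral_right_of_bdd (μ := μ) m2 b2
    exact integrable_of_measurable_abs_le μ hm hb
  have hinner : ∀ x, ∫ y, (A.indicator (fun _ => (1 : ℝ)) x - A.indicator (fun _ => (1 : ℝ)) y) ^ 2 * K x y ∂μ = (∫ y, F₁ x y ∂μ) + ∫ y, F₂ x y ∂μ := fun x => by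
    rw [← integral_add (integrable_of_measurable_abs_le μ (m1.of_uncurry_left) (fun y => b1 x y))
      (integrable_of_measurable_abs_le μ (m2.of_uncurry_left) (fun y => b2 x y))]
    exact integral_congr_ae (ae_of_all _ fun y => hsplit x y)
  simp_rw [hinner]
  rw [integral_add i1 i2, e2, e1]; ring

end Abstract

/-! ## §2 The support `cS` of the central profile is GAUGE-WIDE: pure-gauge points of every radius `≤ r(β)` -/

section Concrete

variable {L : ℕ} [NeZero L]

/-- `t·H` kills the vacuum gauge modes (✓`smul_stiffHessian_vacGrad_eq_zero`), so the frozen stiff exponent VANISHES on them: `q_{t,b}(y) = 0` for `y ∈ Γ`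
(each eigen-term `√(aᵢ² + 2aᵢb)·⟪eᵢ, y⟫²` has `aᵢ = 0` or `⟪eᵢ, y⟫ = 0`, since `aᵢ⟪eᵢ, y⟫ = ⟪eᵢ, tH y⟫ = 0`). [folklore] -/
theorem stiffGaussExp_eq_zero_of_mem_gaugeModes (t b : ℝ) {y : LinkSpace L} (hy : y ∈ gaugeModes L) : stiffGaussExp L t b y = 0 := by
  obtain ⟨φ, rfl⟩ := hy
  have hker : (t • stiffHessian L) (vacGrad L φ) = 0 := smul_stiffHessian_vacGrad_eq_zero t φ
  unfold stiffGaussExp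
  refine Finset.sum_eq_zero fun i _ => ?_
  set hT := isSymmetric_smul_stiffHessian (L := L) t
  set e := hT.eigenvectorBasis finrank_euclideanSpace i
  set a := hT.eigenvalues finrank_euclideanSpace i
  have happ : (t • stiffHessian L) e = (a : ℝ) • e := hT.apply_eigenvectorBasis finrank_euclideanSpace i
  have h1 : a * ⟪e, vacGrad L φ⟫ = 0 := by
    have h2 : ⟪(t • stiffHessian L) e, vacGrad L φ⟫ = ⟪e, (t • stiffHessian L) (vacGrad L φ)⟫ := hT e (vacGrad L φ)
    rwa [hker, inner_zero_right, happ, real_inner_smul_left] at h2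
  rcases mul_eq_zero.mp h1 with h | h
  · rw [h]; simp
  · rw [h]; simp

/-- ★★ **`cS` is gauge-wide.**  For `L ≥ 2` and every radius `0 ≤ R ≤ r(β) = min (1/40) (β^{-1/2} btLog β)` the support `cS L β` of the central profile contains a
PURE-GAUGE point `x` — `y = linkEmbed L x ∈ Γ`, `P_Γ y = y`, `‖y‖ = R` — at which `cΘ L β x = exp(−R²/(powScale 1 β)²)` exactly (the stiff factor is `1` on `Γ`).  So the
support has radius `β^{-1/2}btLog β` in the gauge directions while the profile's gauge Gaussian has width `powScale 1 β = β^{-1}`: a jump kernel `J₀` for the door on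
`S = cS L β` must reach gauge offsets up to `2r(β)`.  Witness: `y = (R/‖d‖)·d`, `d = vacGrad(δ_0 e_0)`. [folklore] -/
theorem exists_mem_cS_pureGauge (hL : 2 ≤ L) (β : ℝ) {R : ℝ} (h0 : 0 ≤ R) (hR : R ≤ min (1 / 40) (powScale (1 / 2) β * btLog β)) :
    ∃ x ∈ cS L β, linkEmbed L x ∈ gaugeModes L ∧ (gaugeModes L).starProjection (linkEmbed L x) = linkEmbed L x ∧ ‖linkEmbed L x‖ = R ∧
      cΘ L β x = Real.exp (-(R ^ 2 / powScale 1 β ^ 2)) := by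
  classical
  -- the site bump `φ₀ = δ_0 e_0` and its vacuum gradient `d ∈ Γ`
  set φ₀ : Site 3 L → Fin 3 → ℝ := fun z a => if z = 0 ∧ a = 0 then 1 else 0 with hφ₀
  set d : LinkSpace L := vacGrad L φ₀ with hd
  have hdΓ : d ∈ gaugeModes L := ⟨φ₀, rfl⟩
  -- `d ≠ 0`: its entry at the link `(0, ê₀)`, colour `0`, is `φ₀(0 + ê₀) − φ₀(0) = −1`
  have hd0 : d ≠ 0 := by
    intro h
    have hs : (0 : Site 3 L).shift 0 ≠ 0 := fun h => by   -- a unit shift moves every site once `L ≥ 2` (cf. ✓`Negative.R11.shift_ne_self`)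
      haveI : Fact (1 < L) := ⟨hL⟩
      simpa [Site.shift] using congr_fun h 0
    have h1 : d (((0 : Site 3 L), (0 : Fin 3)), (0 : Fin 3)) = -1 := by
      show φ₀ ((0 : Site 3 L).shift 0) 0 - φ₀ 0 0 = -1
      simp [hφ₀, hs]
    rw [h] at h1
    norm_num at h1
  have hdn : 0 < ‖d‖ := norm_pos_iff.mpr hd0
  -- the pure-gauge point of radius `R`
  set y : LinkSpace L := (R / ‖d‖) • d with hy
  have hyΓ : y ∈ gaugeModes L := Submodule.smul_mem _ _ hdΓ
  have hyn : ‖y‖ = R := by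
    rw [hy, norm_smul, Real.norm_eq_abs, abs_of_nonneg (div_nonneg h0 hdn.le), div_mul_cancel₀ _ hdn.ne']
  set x : Edge 3 L → Fin 3 → ℝ := linkCurry y with hx
  have hxy : linkEmbed L x = y := by ext ea; rfl
  -- balanced: the site sum of a gradient vanishes (the shift is a bijection of the sites)
  have hbal : x ∈ balancedSet L := by
    rw [mem_balancedSet]
    intro k a
    have hsum : ∑ z : Site 3 L, φ₀ (z.shift k) a = ∑ z : Site 3 L, φ₀ z a :=
      Fintype.sum_equiv (Equiv.addRight (Pi.single k (1 : ZMod L))) _ _ fun z => rfl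
    have hentry : ∀ z : Site 3 L, x (z, k) a = (R / ‖d‖) * (φ₀ (z.shift k) a - φ₀ z a) := fun z => rfl
    simp_rw [hentry]
    rw [← Finset.mul_sum, Finset.sum_sub_distrib, hsum, sub_self, mul_zero]
  -- capped: `Σ_a x e a² ≤ ‖y‖² = R² ≤ (1/40)² ≤ 1/4`
  have hcap : x ∈ capBalancedSet L := by
    refine ⟨hbal, fun e => ?_⟩
    have h1 : ∑ a, x e a ^ 2 ≤ ∑ e', ∑ a, x e' a ^ 2 :=
      Finset.single_le_sum (f := fun e' => ∑ a, x e' a ^ 2) (fun e' _ => Finset.sum_nonneg fun a _ => sq_nonneg _) (Finset.mem_univ e)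
    rw [← norm_linkEmbed_sq L x, hxy, hyn] at h1
    have hR40 : R ≤ 1 / 40 := hR.trans (min_le_left _ _)
    nlinarith
  have hball : y ∈ Metric.closedBall (0 : LinkSpace L) (min (1 / 40) (powScale (1 / 2) β * btLog β)) := by
    rw [Metric.mem_closedBall, dist_zero_right, hyn]; exact hR
  -- evaluate the profile
  have hP : (gaugeModes L).starProjection y = y := Submodule.starProjection_eq_self_iff.mpr hyΓ
  have hq : stiffGaussExp L (β / 2) β y = 0 := stiffGaussExp_eq_zero_of_mem_gaugeModes _ _ hyΓ
  have hmem : y ∈ {y : LinkSpace L | linkCurry y ∈ capBalancedSet L} := hcap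
  have hΘ : cΘ L β x = Real.exp (-(R ^ 2 / powScale 1 β ^ 2)) := by
    simp only [cΘ, cΩ, frozenProfile]
    rw [hxy, indicator_of_mem hmem, indicator_of_mem hball, hP, hyn, hq]
    simp
  refine ⟨x, ?_, by rw [hxy]; exact hyΓ, by rw [hxy]; exact hP, by rw [hxy]; exact hyn, hΘ⟩
  show cΘ L β x ≠ 0
  rw [hΘ]; exact (Real.exp_pos _).ne'

/-- ★ **The gauge factor of ✓`cΘ_floor` is attained**: at the pure-gauge point of maximal radius `r(β)` the central profile EQUALS `exp(−r(β)²/(powScale 1 β)²)`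
(`= exp(−β·btLog²β)` once `β^{-1/2}btLog β ≤ 1/40`): the floor `θ₀` of `spec_gap_inputs` is at most this, and the support is not a `β^{-1}`-ball. [folklore] -/
theorem cΘ_gauge_floor_attained (hL : 2 ≤ L) (β : ℝ) :
    ∃ x ∈ cS L β, (gaugeModes L).starProjection (linkEmbed L x) = linkEmbed L x ∧ ‖linkEmbed L x‖ = min (1 / 40) (powScale (1 / 2) β * btLog β) ∧
      cΘ L β x = Real.exp (-((min (1 / 40) (powScale (1 / 2) β * btLog β)) ^ 2 / powScale 1 β ^ 2)) := by
  have hr : 0 ≤ min (1 / 40) (powScale (1 / 2) β * btLog β) :=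
    le_min (by norm_num) (mul_nonneg (powScale_pos _ _).le (zero_le_one.trans (one_le_btLog β)))
  obtain ⟨x, hx, -, hP, hn, hΘ⟩ := exists_mem_cS_pureGauge (L := L) hL β hr le_rfl
  exact ⟨x, hx, hP, hn, hΘ⟩

/-- ★ **Every floor is at most the attained gauge value**: if `θ₀ ≤ cΘ` on `cS L β` (the `hΘlo` input of the door / of `spec_gap_inputs`) then
`θ₀ ≤ exp(−r(β)²/(powScale 1 β)²)`. [folklore] -/
theorem floor_le_gauge_value (hL : 2 ≤ L) (β : ℝ) {θ₀ : ℝ} (hΘlo : ∀ x ∈ cS L β, θ₀ ≤ cΘ L β x) :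
    θ₀ ≤ Real.exp (-((min (1 / 40) (powScale (1 / 2) β * btLog β)) ^ 2 / powScale 1 β ^ 2)) := by
  obtain ⟨x, hx, -, -, hΘ⟩ := cΘ_gauge_floor_attained (L := L) hL β
  rw [← hΘ]; exact hΘlo x hx

/-! ## §3 The conductance floor for the literal (B-ST) fibre data -/

/-- ★★ **Conductance floor, literal objects.**  For the fibre block of ✓`…BOStiffDefs` (`S = cS L β`, `Θ = cΘ L β`, `M = cM L β` — symmetric, bounded, measurable by
✓`…BOStiffCentralData` — and `Λ = cΛ L s M β > 0`) and ANY data `(D, J₀, P₀, δ, c_J)` satisfying the jump floor `hJ` and the flat Poincaré inequality `hflat` of the inner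
block of `spec_gap_inputs` (verbatim shapes), every measurable `A ⊆ cS L β` obeys
`(c_J·cΛ/P₀)·(D(A)(1 − δ) − D(A)²/D(cS)) ≤ ∫_A ∫_{Aᶜ} cΘ(x)·cM(x,y)·cΘ(y) dπ(y) dπ(x)`:
the Poincaré constant fed to the door is floored by `c_J·cΛ` over the `cΘcMcΘ`-conductance of `A` in `cS` — for every `A`, in particular for far gauge shells of the
gauge-wide support (§2). [folklore] -/
theorem central_conductance_floor (β s M : ℝ) (hΛ : 0 < cΛ L s M β) {A : Set (Edge 3 L → Fin 3 → ℝ)} (hA : MeasurableSet A) (hAS : A ⊆ cS L β)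
    {D : (Edge 3 L → Fin 3 → ℝ) → ℝ} {J₀ : (Edge 3 L → Fin 3 → ℝ) → (Edge 3 L → Fin 3 → ℝ) → ℝ} {P₀ δ cJ CJ : ℝ} (hP₀ : 0 < P₀) (hcJ : 0 < cJ)
    (hJ₀ : Measurable (Function.uncurry J₀)) (hJ₀b : ∀ x y, |J₀ x y| ≤ CJ)
    (hJ : ∀ x y, cJ * (cΛ L s M β * J₀ x y) ≤ cΘ L β x * cM L β x y * cΘ L β y)
    (hflat : ∀ g : (Edge 3 L → Fin 3 → ℝ) → ℝ, Measurable g → (∃ C : ℝ, ∀ x, |g x| ≤ C) → (∀ x, x ∉ cS L β → g x = 0) →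
      (∫ x in cS L β, g x ^ 2 * D x ∂orthoTransverse L) - (∫ x in cS L β, g x * D x ∂orthoTransverse L) ^ 2 / (∫ x in cS L β, D x ∂orthoTransverse L) ≤
        P₀ * ((1 / 2) * ∫ x, ∫ y, (g x - g y) ^ 2 * J₀ x y ∂orthoTransverse L ∂orthoTransverse L) + δ * ∫ x in cS L β, g x ^ 2 * D x ∂orthoTransverse L) :
    (cJ * cΛ L s M β / P₀) * ((∫ x in A, D x ∂orthoTransverse L) * (1 - δ) - (∫ x in A, D x ∂orthoTransverse L) ^ 2 / ∫ x in cS L β, D x ∂orthoTransverse L) ≤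
      ∫ x in A, ∫ y in Aᶜ, cΘ L β x * cM L β x y * cΘ L β y ∂orthoTransverse L ∂orthoTransverse L := by
  haveI := isFiniteMeasure_orthoTransverse L
  obtain ⟨C, hC⟩ := cM_bounds (L := L) β
  have hΘb : ∀ x, |cΘ L β x| ≤ 1 := fun x => (cΘ_mem_Icc β x).2.2
  have h := conductance_floor (μ := orthoTransverse L) hA hAS hP₀ hcJ hΛ (measurable_cM β) (fun x y => (hC x y).2.2) (measurable_cΘ β) hΘb hJ₀ hJ₀b hJ hflat
  have hKm : Measurable (Function.uncurry fun x y => cΘ L β x * cM L β x y * cΘ L β y) :=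
    (((measurable_cΘ β).comp measurable_fst).mul (measurable_cM β)).mul ((measurable_cΘ β).comp measurable_snd)
  have hKb : ∀ x y, |cΘ L β x * cM L β x y * cΘ L β y| ≤ 1 * C * 1 := fun x y => by
    rw [abs_mul, abs_mul]
    exact mul_le_mul (mul_le_mul (hΘb x) (hC x y).2.2 (abs_nonneg _) zero_le_one) (hΘb y) (abs_nonneg _) (mul_nonneg zero_le_one ((hC x y).1.trans (hC x y).2.1))
  have hsymm : ∀ x y, cΘ L β x * cM L β x y * cΘ L β y = cΘ L β y * cM L β y x * cΘ L β x := fun x y => by rw [cM_symm β x y]; ring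
  rw [half_jump_indicator_eq (μ := orthoTransverse L) hA hKm hKb hsymm] at h
  exact h

end Concrete

end Summit.QuantumFields.YangMills.Theorems.TwistedTraceScaling.Negative.R66

end
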